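import Summits.CriticalPhenomena.CardyFormulaZ2.Theses.CardyQContinuation
import Literature.Probability.LatticeModels.FKTwoArcPartitionPolynomials

/-!
# Wiring normalisations of the critical FK-Ising two-arc crossing ratio — the Möbius transfer
(route CardyQContinuation, serves stmt-CriticalPhenomena-5560)

The `n = 0` case of the crux `IsingJetsConformal` (stmt-CriticalPhenomena-5560) of route
CardyQContinuation asks that the self-dual crossing ratio `P_δ(√2) = N_δ(√2) / Z^joint_δ(√2)` of a
conformal rectangle (critical FK-Ising, `q = 2`; the arcs `(ab)_δ ∪ (cd)_δ` wired JOINTLY, so that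
`Z^joint_δ = N_δ + M_δ` with `M_δ` the non-crossing part) converge as `δ → 0⁺`. The published
scaling-limit theorem one wants to transplant (Chelkak–Smirnov 2012, Thm 6.1, per the crux text:
"`P_joint = √2·p/(√2·p + 1 − p)`, `p` = CS's (6.1)") is stated in the LOOP-SYMMETRIC
normalisation `N_δ / (N_δ + √2 M_δ)` (each of the two possible boundary-cluster topologies
weighted like one loop of weight `√q = √2`; the SEPARATE wiring would give `N_δ / (N_δ + 2 M_δ)`,
cf. `fkTwoArcPartitionPolynomials_separate_add`). The three ratios are Möbius images of the
quotient `N_δ / M_δ`, so a limit in one normalisation is a limit in every other.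

This file proves that transfer, abstractly and for the two-arc polynomials of
`Literature/Probability/LatticeModels/FKTwoArcPartitionPolynomials.lean`:

* `tendsto_div_add_of_tendsto_div_add_mul`: for `θ, κ > 0` and eventually nonnegative `a, b` with
  `a + b > 0`, if `a/(a + θ b) → p` then `a/(a + κ b) → θ p / (θ p + κ (1 - p))`;
  `tendsto_div_add_of_tendsto_div_add_sqrt_two_mul`: the case `θ = √2`, `κ = 1`;
* `aeval_fkTwoArcPartitionPolynomials_pos`, `aeval_fkTwoArcCrossingPolynomial_nonneg`,
  `aeval_fkTwoArcCrossingPolynomial_le`: `Z_δ(t) > 0` (`δ, t > 0`), `0 ≤ N_δ(t) ≤ Z_δ(t)` (`t ≥ 0`);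
* `tendsto_aeval_div_of_tendsto_loopSymmetric`: for a conformal rectangle `R`, if
  `N_δ(√2) / (N_δ(√2) + √2 (Z^joint_δ(√2) - N_δ(√2))) → p` as `δ → 0⁺` then
  `N_δ(√2) / Z^joint_δ(√2) → √2 p / (√2 p + 1 - p)`.

Combined with `tendsto_crossingRatio_ofReal_iff` of the companion file
`Theorems/CardyQContinuationIsingJetsConformalStubIsingCrossingConformal.lean` (the dictionary
between the route's inline `P_δ` and `N_δ / Z^joint_δ`), the last statement converts a
loop-symmetric crossing limit for `R` into the limit of the route's inline `P_δ(√2)`.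
NOT here: any scaling-limit statement (Chelkak–Smirnov 2012 Thm 6.1 is not in the tree).

References: D. Chelkak, S. Smirnov, Invent. Math. 189 (2012), §6, Thm 6.1; G. Grimmett, *The
Random-Cluster Model* (2006), §6.1 eq. (6.9).
-/

namespace Summit.CriticalPhenomena.CardyFormulaZ2.Theorems.CardyQContinuation

open Filter Set Polynomial
open scoped Topology Polynomial
open Literature.Probability.LatticeModels Literature.Probability.Percolation
open Literature.Probability.RandomPlanarGeometry

noncomputable section

/-! ### Sign information on the two-arc polynomials -/

section Sign

variable (R : ConformalRectangle) {δ : ℝ}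

/-- For `δ > 0` and `t > 0` the partition polynomial is positive at `t` (the empty configuration
contributes `t ^ (2 k_B(∅)) > 0`, all terms are nonnegative). [folklore] -/
theorem aeval_fkTwoArcPartitionPolynomials_pos (hδ : 0 < δ) {t : ℝ} (ht : 0 < t) (w : ArcWiring) :
    0 < aeval t (fkTwoArcPartitionPolynomials R δ w) := by
  classical
  letI : Fintype (meshDomain R.carrier δ) := (meshDomain_finite R.isBounded hδ).fintype
  rw [fkTwoArcPartitionPolynomials_of_pos R hδ, aeval_rcArcPolynomial]
  exact Finset.sum_pos (fun _ _ => pow_pos ht _) ⟨∅, Finset.empty_mem_powerset _⟩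

/-- The crossing polynomial is nonnegative at `t ≥ 0`. [folklore] -/
theorem aeval_fkTwoArcCrossingPolynomial_nonneg {t : ℝ} (ht : 0 ≤ t) (w : ArcWiring) :
    0 ≤ aeval t (fkTwoArcCrossingPolynomial R δ w) := by
  classical
  rcases le_or_gt δ 0 with hδ | hδ
  · simp [fkTwoArcCrossingPolynomial_of_nonpos R hδ]
  · letI : Fintype (meshDomain R.carrier δ) := (meshDomain_finite R.isBounded hδ).fintype
    rw [fkTwoArcCrossingPolynomial_of_pos R hδ, aeval_rcArcPolynomialIn]
    exact Finset.sum_nonneg fun _ _ => pow_nonneg ht _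

/-- `N_δ(t) ≤ Z_δ(t)` at `t ≥ 0` (the crossing polynomial is a sub-sum of the partition polynomial),
so that `M_δ(t) = Z^joint_δ(t) - N_δ(t)`, the non-crossing part, is nonnegative. [folklore] -/
theorem aeval_fkTwoArcCrossingPolynomial_le {t : ℝ} (ht : 0 ≤ t) (w : ArcWiring) :
    aeval t (fkTwoArcCrossingPolynomial R δ w) ≤ aeval t (fkTwoArcPartitionPolynomials R δ w) := by
  classical
  rcases le_or_gt δ 0 with hδ | hδ
  · simp [fkTwoArcCrossingPolynomial_of_nonpos R hδ, fkTwoArcPartitionPolynomials_of_nonpos R hδ]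
  · letI : Fintype (meshDomain R.carrier δ) := (meshDomain_finite R.isBounded hδ).fintype
    rw [fkTwoArcCrossingPolynomial_of_pos R hδ, aeval_rcArcPolynomialIn,
      fkTwoArcPartitionPolynomials_of_pos R hδ, aeval_rcArcPolynomial]
    exact Finset.sum_le_sum_of_subset_of_nonneg (Finset.filter_subset _ _)
      fun _ _ _ => pow_nonneg ht _

end Sign

/-! ### Möbius transfer between wiring normalisations -/

/-- **Möbius transfer between normalisations of a crossing probability.** For `θ, κ > 0` and
eventually nonnegative `a, b` with `a + b > 0`: if `a / (a + θ b) → p` along a filter then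
`a / (a + κ b) → θ p / (θ p + κ (1 - p))` (pointwise `a/(a + κ b)` is this Möbius function of
`a/(a + θ b)`, whose pole `p = κ/(κ - θ)` lies outside `[0, 1] ∋ p`). With `a = N_δ(√2)`,
`b = M_δ(√2)` (crossing / non-crossing parts of the FK-Ising two-arc sums) this relates the
loop-symmetric normalisation `N/(N + √2 M)` (`θ = √2`; Chelkak–Smirnov 2012, Thm 6.1), the joint
wiring `N/(N + M)` (`κ = 1`) and the separate wiring `N/(N + 2M)` (`κ = 2`). [folklore] -/
theorem tendsto_div_add_of_tendsto_div_add_mul {ι : Type*} {l : Filter ι} {a b : ι → ℝ}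
    {θ κ p : ℝ} (hθ : 0 < θ) (hκ : 0 < κ) (ha : ∀ᶠ i in l, 0 ≤ a i) (hb : ∀ᶠ i in l, 0 ≤ b i)
    (hab : ∀ᶠ i in l, 0 < a i + b i)
    (h : Tendsto (fun i => a i / (a i + θ * b i)) l (𝓝 p)) :
    Tendsto (fun i => a i / (a i + κ * b i)) l (𝓝 (θ * p / (θ * p + κ * (1 - p)))) := by
  rcases eq_or_neBot l with rfl | hl
  · exact tendsto_bot
  -- the values, hence the limit, lie in `[0, 1]`
  have hmem : ∀ᶠ i in l, a i / (a i + θ * b i) ∈ Set.Icc (0 : ℝ) 1 := by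
    filter_upwards [ha, hb, hab] with i hai hbi habi
    have hden : 0 < a i + θ * b i := by
      rcases hbi.eq_or_lt with hb0 | hb0
      · rw [← hb0] at habi ⊢; simpa using habi
      · positivity
    exact ⟨div_nonneg hai hden.le, (div_le_one hden).2 (by nlinarith)⟩
  have hp : p ∈ Set.Icc (0 : ℝ) 1 := isClosed_Icc.mem_of_tendsto h hmem
  have hne : θ * p + κ * (1 - p) ≠ 0 := by
    have h1 : 0 ≤ θ * p := mul_nonneg hθ.le hp.1
    have h2 : 0 ≤ κ * (1 - p) := mul_nonneg hκ.le (sub_nonneg.2 hp.2)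
    rcases hp.1.eq_or_lt with hp0 | hp0
    · rw [← hp0]; simpa using hκ.ne'
    · have : 0 < θ * p := mul_pos hθ hp0
      positivity
  have hlim : Tendsto (fun i => θ * (a i / (a i + θ * b i)) /
      (θ * (a i / (a i + θ * b i)) + κ * (1 - a i / (a i + θ * b i)))) l
      (𝓝 (θ * p / (θ * p + κ * (1 - p)))) :=
    (h.const_mul θ).div ((h.const_mul θ).add ((tendsto_const_nhds.sub h).const_mul κ)) hne
  refine hlim.congr' ?_
  filter_upwards [ha, hb, hab] with i hai hbi habi
  have hden : 0 < a i + θ * b i := by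
    rcases hbi.eq_or_lt with hb0 | hb0
    · rw [← hb0] at habi ⊢; simpa using habi
    · positivity
  have hden' : 0 < a i + κ * b i := by
    rcases hbi.eq_or_lt with hb0 | hb0
    · rw [← hb0] at habi ⊢; simpa using habi
    · positivity
  have h1 : θ * (a i / (a i + θ * b i)) = θ * a i / (a i + θ * b i) := (mul_div_assoc _ _ _).symm
  have h2 : κ * (1 - a i / (a i + θ * b i)) = κ * θ * b i / (a i + θ * b i) := by
    field_simp
    ring
  rw [h1, h2, ← add_div, div_div_div_cancel_right₀ hden.ne',
    show θ * a i + κ * θ * b i = θ * (a i + κ * b i) by ring, mul_div_mul_left _ _ hθ.ne']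

/-- **The `√2` case** (FK-Ising, `q = 2`): if the loop-symmetrically normalised crossing ratio
`a/(a + √2 b)` of Chelkak–Smirnov 2012, Thm 6.1 tends to `p`, then the jointly-wired ratio
`a/(a + b)` of route CardyQContinuation tends to `√2 p / (√2 p + 1 - p)`. [folklore] -/
theorem tendsto_div_add_of_tendsto_div_add_sqrt_two_mul {ι : Type*} {l : Filter ι} {a b : ι → ℝ}
    {p : ℝ} (ha : ∀ᶠ i in l, 0 ≤ a i) (hb : ∀ᶠ i in l, 0 ≤ b i) (hab : ∀ᶠ i in l, 0 < a i + b i)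
    (h : Tendsto (fun i => a i / (a i + Real.sqrt 2 * b i)) l (𝓝 p)) :
    Tendsto (fun i => a i / (a i + b i)) l
      (𝓝 (Real.sqrt 2 * p / (Real.sqrt 2 * p + 1 - p))) := by
  have := tendsto_div_add_of_tendsto_div_add_mul (Real.sqrt_pos.2 two_pos) one_pos ha hb hab h
  simp only [one_mul] at this
  convert this using 3
  ring

/-- **Loop-symmetric limit ⇒ joint limit, for the two-arc polynomials at `√2`.** If for the
conformal rectangle `R` the critical FK-Ising crossing ratio in the loop-symmetric normalisation
`N_δ(√2) / (N_δ(√2) + √2 M_δ(√2))`, `M_δ = Z^joint_δ - N_δ` (the quantity `p` of Chelkak–Smirnov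
2012, Thm 6.1 in the crux text of stmt-CriticalPhenomena-5560), tends to `p` as `δ → 0⁺`, then the
jointly normalised ratio `N_δ(√2) / Z^joint_δ(√2)` (= the route's `P_δ(√2)`, by
`tendsto_crossingRatio_ofReal_iff` of the companion file) tends to `√2 p / (√2 p + 1 - p)`.
[folklore] -/
theorem tendsto_aeval_div_of_tendsto_loopSymmetric (R : ConformalRectangle) {p : ℝ}
    (h : Tendsto (fun δ : ℝ => aeval (Real.sqrt 2) (fkTwoArcCrossingPolynomial R δ .joint) /
        (aeval (Real.sqrt 2) (fkTwoArcCrossingPolynomial R δ .joint) + Real.sqrt 2 *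
          (aeval (Real.sqrt 2) (fkTwoArcPartitionPolynomials R δ .joint) -
            aeval (Real.sqrt 2) (fkTwoArcCrossingPolynomial R δ .joint))))
      (𝓝[>] 0) (𝓝 p)) :
    Tendsto (fun δ : ℝ => aeval (Real.sqrt 2) (fkTwoArcCrossingPolynomial R δ .joint) /
        aeval (Real.sqrt 2) (fkTwoArcPartitionPolynomials R δ .joint))
      (𝓝[>] 0) (𝓝 (Real.sqrt 2 * p / (Real.sqrt 2 * p + 1 - p))) := by
  have h2 : (0 : ℝ) ≤ Real.sqrt 2 := Real.sqrt_nonneg 2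
  have hpos : ∀ᶠ δ in 𝓝[>] (0 : ℝ), 0 < δ := self_mem_nhdsWithin
  have key := tendsto_div_add_of_tendsto_div_add_sqrt_two_mul
    (l := 𝓝[>] (0 : ℝ))
    (a := fun δ => aeval (Real.sqrt 2) (fkTwoArcCrossingPolynomial R δ .joint))
    (b := fun δ => aeval (Real.sqrt 2) (fkTwoArcPartitionPolynomials R δ .joint) -
      aeval (Real.sqrt 2) (fkTwoArcCrossingPolynomial R δ .joint))
    (Eventually.of_forall fun δ => aeval_fkTwoArcCrossingPolynomial_nonneg R h2 _)
    (Eventually.of_forall fun δ => sub_nonneg.2 (aeval_fkTwoArcCrossingPolynomial_le R h2 _))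
    (by
      filter_upwards [hpos] with δ hδ
      simpa using aeval_fkTwoArcPartitionPolynomials_pos R hδ (Real.sqrt_pos.2 two_pos) .joint)
    h
  simpa using key

end

end Summit.CriticalPhenomena.CardyFormulaZ2.Theorems.CardyQContinuation
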